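import Literature.MathematicalPhysics.QuantumFieldTheory.Federbush1986.AxialTreeConsistency
import Literature.MathematicalPhysics.QuantumFieldTheory.Federbush1986.PlaquetteTop
import Literature.MathematicalPhysics.QuantumFieldTheory.Federbush1986.LatticeGaugeFunction

/-!
# `Federbush1986.AxialTreePureGauge` — [Federbush1986PhaseCellI] §4 p. 329 «Mirabile dictu the bond assignments to e at
# level 0, due to this A_μ(x), are exactly the A(e)»: Bałaban averaging (axial trees, corner base points) of a PURE GAUGE
# `dΛ` is the lattice gradient of `Λ|ℤ⁴` — PROVED for the concrete `axialTreeAveraging`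

statement-level skeleton of published theorems with citation tags; proofs where landed; nothing here is a claim about the Yang–Mills mass gap

CITATION HEADER.  P. Federbush, *A phase cell approach to Yang–Mills theory. I*, Commun. Math. Phys. **107** (1986) 319–329
[Federbush1986PhaseCellI] (render `run/shared/lean/pub/lit-balaban/lit-balaban-r17/renders/fedI/fed1986-cmp107-p011-x2.png`,
p. 329, re-read as image), verbatim: *«We let this be the Λ(x) of (3.2) [A_μ = A^N_μ + ∂_μΛ].  Clearly A_μ(x) given by (3.2)
satisfies the bounds in (3.13)–(3.15).  Mirabile dictu the bond assignments to e at level 0, due to this A_μ(x), are exactly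
the A(e).»* — with (4.3) `A(e) − A^N(e) = h(b) − h(a)` and (4.5) `Λ(x) = h(x), x ∈ Z⁴`.  The averaging is §1 (1.1),
(1.10)–(1.11) p. 321–324 (Bałaban, CMP **95** (1984) (1.8) [Balaban1984PropagatorsI]) with «the base point … a corner of the
block» (p. 321); the level-`r` assignments are (2.1)–(2.2) p. 325 and the bond assignment is the limit (2.12).  Unit
`lit-balaban-p04` gen 6; SKELETON rows F1.Eq4.1-4.6 / F1.Eq1.10-1.11 (concrete averaging `axialTreeAveraging`, r17 p240138)
of `run/shared/lean/pub/lit-balaban/lit-balaban-r17/SKELETON-r17.md`; companions `LatticeGaugeFunction` ((4.3)–(4.4)),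
`SmoothGaugeInterpolation` ((4.5)–(4.6)), `GaugeTransformDecay` ((3.2); not imported — the transform is spelt out).

THE MATHEMATICS (why «mirabile dictu» holds — gauge covariance of Bałaban's averaging).
(i) COMBINATORICS (`AxialTree.avStep_gradCfg`): for a lattice gradient `c(b, μ) = g(b + e_μ) − g(b)` every path functional
telescopes, `A_Γ(c) = g(end Γ) − g(start Γ)` (`evalSteps_gradCfg`); the one-step average (1.1)/(1.10) of the coarse bond
`(b, μ)` averages `A_{Γ_x}(c)` over paths `Γ_x` from the base point `2b` to the base point `2b + 2e_μ`, so
`avStep c (b, μ) = g(2(b + e_μ)) − g(2b)`: the average of a gradient is the gradient of `g ∘ (2·)`; iterating,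
`avStep^{[k]}` gives the gradient of `g ∘ (2^k ·)` (`iterate_avStep_gradCfg`).
(ii) THE TOP LEVEL (`approxTop_pureGauge`): by r17's `setIntegral_lineInt_eq_approxTop` (PlaquetteTop, p. 325 «yields the
correct plaquette variables») the level-`r` assignment (2.1)–(2.2) is the average over `u ∈ [0,1]⁴` of the line integrals
`∫_0^{ℓ_r} A_i(x_e + ℓ_r u + t e_i) dt`, and for `A = dΛ` the line integral is `Λ(end) − Λ(start)` (FTC, `lineInt_pureGauge`):
so `A(e, r)` for `dΛ` is the lattice gradient of the BOX AVERAGE `M_rΛ(x) = ∫_{[0,1]⁴} Λ(x + ℓ_r u) du` at the level-`r` points.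
(iii) Hence (`bondApprox_pureGauge`) the level-0 approximant `av_{0←r}(A(·, r))` of `dΛ` at the unit bond `(n, i)` is
`M_rΛ(n + e_i) − M_rΛ(n)` (`ℓ_r 2^r n = n`), which tends to `Λ(n + e_i) − Λ(n)` (`tendsto_boxAvg`, continuity of `Λ`):
**`bond_pureGauge`** — the level-0 bond assignment (2.12) of a pure gauge is the lattice gradient of `Λ|ℤ⁴`.
(iv) Bałaban averaging and (2.1) are linear (`bondApprox_add`), and the approximants of `A^N` converge ((2.12),
r17's `axialTreeAveraging_eq212`), so `bond₀(A^N + dΛ)(e) = bond₀(A^N)(e) + Λ(b) − Λ(a) = A^N(e) + h(b) − h(a) = A(e)` by (4.5)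
and (4.3): **`bond_gaugeTransform_eq_data`** («Mirabile dictu»), and with `h` the lattice gauge function of (4.3)
(`LatticeGauge.gaugeFn`, p253679) **`bond_gaugeTransform_eq_data_of_gaugeFn`**.

WHAT THIS MODULE PROVIDES.  Defs `AxialTree.gradCfg` (lattice gradient configuration), `pureGauge` (`dΛ` as a potential),
`boxAvg` (`M_rΛ`), all with bodies; the theorems named above and their helpers.  No new `Prop` fact; axioms standard.
-/

namespace Literature.MathematicalPhysics.QuantumFieldTheory.Federbush1986

open Filter Set MeasureTheory
open scoped Topology

noncomputable section

namespace AxialTree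

/-! ## §1  Bałaban averaging of a lattice gradient (gauge covariance of (1.1)/(1.10)) -/

/-- The lattice gradient configuration of `g : ℤ⁴ → ℝ`: `c(b, μ) = g(b + e_μ) − g(b)` (a lattice pure gauge).
[cite: Federbush1986PhaseCellI, (4.3) p. 329; §1 p. 321] -/
def gradCfg (g : (Fin 4 → ℤ) → ℝ) : Cfg := fun b μ => g (b + Pi.single μ 1) - g b

/-- Path functionals of a lattice gradient telescope: `A_Γ(∇g) = g(end Γ) − g(start Γ)`. [cite: Federbush1986PhaseCellI, §1
p. 322 («for any oriented path, A_Γ = Σ A(e_i)»)] -/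
theorem evalSteps_gradCfg (g : (Fin 4 → ℤ) → ℝ) :
    ∀ (steps : List (Fin 4 × Bool)) (v : Fin 4 → ℤ), evalSteps (gradCfg g) v steps = g (endpt v steps) - g v := by
  intro steps
  induction steps with
  | nil => intro v; simp [evalSteps, endpt]
  | cons st t ih =>
    intro v
    obtain ⟨μ, b⟩ := st
    simp only [evalSteps, endpt]
    rw [ih]
    cases b <;> simp [sgnR, edgeBase, move, gradCfg]

/-- The axial tree path of a block ends at the block vertex `b + δ̂`. [cite: Federbush1986PhaseCellI, §1 p. 321–322] -/
theorem endpt_treeSteps' (b : Fin 4 → ℤ) (δ : Fin 4 → Bool) : endpt b (treeSteps δ) = b + hat δ := by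
  simp only [treeSteps]
  cases h0 : δ 0 <;> cases h1 : δ 1 <;> cases h2 : δ 2 <;> cases h3 : δ 3 <;>
    · simp [endpt, move]
      funext k
      fin_cases k <;> simp [hat, h0, h1, h2, h3]

/-- The tree functional of a lattice gradient: `treeSum (∇g) b δ = g(b + δ̂) − g(b)`. [cite: Federbush1986PhaseCellI, §1
p. 321–322] -/
theorem treeSum_gradCfg (g : (Fin 4 → ℤ) → ℝ) (b : Fin 4 → ℤ) (δ : Fin 4 → Bool) :
    treeSum (gradCfg g) b δ = g (b + hat δ) - g b := by
  rw [treeSum_eq_evalSteps, evalSteps_gradCfg, endpt_treeSteps']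

/-- [folklore] -/
private theorem twice_add_single' (v : Fin 4 → ℤ) (μ : Fin 4) :
    twice (v + Pi.single μ 1) = twice v + Pi.single μ 2 := by
  funext k; simp [twice, Pi.single_apply]; split_ifs <;> ring

/-- [folklore] -/
private theorem twice_add_hat_add_single_add_single' (v : Fin 4 → ℤ) (μ : Fin 4) (δ : Fin 4 → Bool) :
    twice v + hat δ + Pi.single μ 1 + Pi.single μ 1 = twice v + Pi.single μ 2 + hat δ := by
  funext k; simp [twice, hat, Pi.single_apply]; split_ifs <;> ring

/-- `A(Γ_x)(∇g) = g(2b + 2e_μ) − g(2b)` for every block vertex `x = 2b + δ̂`: the path `Γ_x` runs from the base point `2b` to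
the base point `2(b + e_μ)`. [cite: Federbush1986PhaseCellI, (1.1)–(1.2) p. 321–322; Balaban1984PropagatorsI, (1.8) p. 19] -/
theorem pathSum_gradCfg (g : (Fin 4 → ℤ) → ℝ) (b : Fin 4 → ℤ) (μ : Fin 4) (δ : Fin 4 → Bool) :
    pathSum (gradCfg g) b μ δ = g (twice (b + Pi.single μ 1)) - g (twice b) := by
  have h : pathSum (gradCfg g) b μ δ = treeSum (gradCfg g) (twice b) δ + gradCfg g (twice b + hat δ) μ
      + gradCfg g (twice b + hat δ + Pi.single μ 1) μ - treeSum (gradCfg g) (twice b + Pi.single μ 2) δ := rfl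
  rw [h, treeSum_gradCfg, treeSum_gradCfg, twice_add_single']
  simp only [gradCfg]
  rw [twice_add_hat_add_single_add_single']
  ring

/-- **Gauge covariance of one averaging step**: the Bałaban average (corner base points) of a lattice gradient is the lattice
gradient of `g ∘ (2·)`: `avStep (∇g) = ∇(g ∘ twice)`. [cite: Federbush1986PhaseCellI, (1.1), (1.10) p. 322–323;
Balaban1984PropagatorsI, (1.8) p. 19] -/
theorem avStep_gradCfg (g : (Fin 4 → ℤ) → ℝ) : avStep (gradCfg g) = gradCfg (fun v => g (twice v)) := by
  funext b μ
  simp only [avStep, pathSum_gradCfg, Finset.sum_const, Finset.card_univ, Fintype.card_fun, Fintype.card_bool,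
    Fintype.card_fin, nsmul_eq_mul, gradCfg]
  norm_num
  ring

/-- Iterated: `avStep^{[k]} (∇g) = ∇(g ∘ twice^{[k]})` ((1.11) «By iterating …»). [cite: Federbush1986PhaseCellI, (1.11)
p. 323–324] -/
theorem iterate_avStep_gradCfg (g : (Fin 4 → ℤ) → ℝ) (k : ℕ) :
    avStep^[k] (gradCfg g) = gradCfg (fun v => g (twice^[k] v)) := by
  induction k generalizing g with
  | zero => rfl
  | succ k ih =>
    rw [Function.iterate_succ_apply, avStep_gradCfg, ih]
    congr 1
    funext v
    rw [Function.iterate_succ_apply']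

/-- `twice^{[k]} v = 2^k v`. [folklore] -/
private theorem iterate_twice' (k : ℕ) (v : Fin 4 → ℤ) : twice^[k] v = fun i => 2 ^ k * v i := by
  induction k generalizing v with
  | zero => funext i; simp
  | succ k ih =>
    funext i
    rw [Function.iterate_succ_apply', ih]
    simp [twice]
    ring

/-! ## §1b  Linearity of the averaging -/

/-- `treeSum` is additive in the configuration. [folklore] -/
private theorem treeSum_add' (f g : Cfg) (b : Fin 4 → ℤ) (δ : Fin 4 → Bool) :
    treeSum (fun b μ => f b μ + g b μ) b δ = treeSum f b δ + treeSum g b δ := by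
  simp only [treeSum]
  rw [← Finset.sum_add_distrib]
  refine Finset.sum_congr rfl fun k _ => ?_
  split_ifs <;> ring

/-- `avStep` is additive in the configuration (averages of sums). [cite: Federbush1986PhaseCellI, (1.1) p. 322] -/
theorem avStep_add' (f g : Cfg) : avStep (fun b μ => f b μ + g b μ) = fun b μ => avStep f b μ + avStep g b μ := by
  funext b μ
  have hp : ∀ δ : Fin 4 → Bool, pathSum (fun b μ => f b μ + g b μ) b μ δ = pathSum f b μ δ + pathSum g b μ δ := by
    intro δ
    simp only [pathSum, treeSum_add']
    ring
  simp only [avStep, hp, Finset.sum_add_distrib]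
  ring

/-- The iterated average is additive. [cite: Federbush1986PhaseCellI, (1.11) p. 323–324] -/
theorem iterate_avStep_add' (k : ℕ) (f g : Cfg) :
    avStep^[k] (fun b μ => f b μ + g b μ) = fun b μ => (avStep^[k] f) b μ + (avStep^[k] g) b μ := by
  induction k generalizing f g with
  | zero => rfl
  | succ k ih => rw [Function.iterate_succ_apply, Function.iterate_succ_apply, Function.iterate_succ_apply, avStep_add', ih]

end AxialTree

open AxialTree

/-! ## §2  The top level (2.1)–(2.2) of a pure gauge -/

/-- The pure gauge potential `dΛ`: `(dΛ)_μ(x) = ∂_μΛ(x)` (so that (3.2) reads `A = A^N + pureGauge Λ`; this is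
`AbelianAveraging.gaugeTransform A^N Λ` of `GaugeTransformDecay` by `rfl`).
[cite: Federbush1986PhaseCellI, (3.2) p. 327] -/
def pureGauge (Λ : E4 → ℝ) : E4 → Fin 4 → ℝ := fun x μ => fderiv ℝ Λ x (unitVec μ)

variable {Λ : E4 → ℝ}

/-- `dΛ` is continuous for `Λ ∈ C¹`.  Print takes (2.1) under «[We always assume A_μ(x) is continuously differentiable.]» (§2 p. 325,
verbatim); the tree's (2.1)/(2.12) (`axialTreeAveraging`) is stated for every potential and its convergence theory uses continuity,
which for `A = dΛ` is `Λ ∈ C¹` — a weaker hypothesis than print's.  (v1.1 DOCFIX DF-g46-2, ref-5 gen 46: the v1 docstring's «A_μ(x)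
(assumed continuous)» was our paraphrase, not a quotation; declaration untouched.) [cite: Federbush1986PhaseCellI, (3.2) p. 327, §2 p. 325] -/
theorem continuous_pureGauge (hΛ : ContDiff ℝ 1 Λ) : Continuous (pureGauge Λ) :=
  continuous_pi fun _ => (hΛ.continuous_fderiv one_ne_zero).clm_apply continuous_const

/-- **FTC along a lattice direction**: `∫_0^ℓ (dΛ)_i(x + t e_i) dt = Λ(x + ℓe_i) − Λ(x)`. [cite: Federbush1986PhaseCellI, (1.13)
p. 324, (2.1) p. 325] -/
theorem lineInt_pureGauge (hΛ : ContDiff ℝ 1 Λ) (x : E4) (i : Fin 4) (ℓ : ℝ) :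
    lineInt (pureGauge Λ) x i ℓ = Λ (x + ℓ • unitVec i) - Λ x := by
  have hpath : ∀ t : ℝ, HasDerivAt (fun t : ℝ => x + t • (unitVec i : E4)) (unitVec i) t := fun t => by
    simpa using ((hasDerivAt_id t).smul_const (unitVec i : E4)).const_add x
  have hderiv : ∀ t : ℝ,
      HasDerivAt (fun t : ℝ => Λ (x + t • unitVec i)) (fderiv ℝ Λ (x + t • unitVec i) (unitVec i)) t :=
    fun t => (((hΛ.differentiable one_ne_zero) _).hasFDerivAt).comp_hasDerivAt t (hpath t)
  have hcont : Continuous fun t : ℝ => fderiv ℝ Λ (x + t • unitVec i) (unitVec i) :=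
    ((hΛ.continuous_fderiv one_ne_zero).comp (continuous_const.add (continuous_id.smul continuous_const))).clm_apply
      continuous_const
  unfold lineInt pureGauge
  rw [intervalIntegral.integral_eq_sub_of_hasDerivAt (fun t _ => hderiv t) (hcont.intervalIntegrable _ _)]
  simp

/-- The box average `M_rΛ(x) = ∫_{[0,1]⁴} Λ(x + ℓ_r u) du` (the scale-`ℓ_r` block mean with corner `x`).
[cite: Federbush1986PhaseCellI, (2.1)–(2.2) p. 325] -/
def boxAvg (r : ℕ) (Λ : E4 → ℝ) (x : E4) : ℝ := ∫ u in Icc (0 : Fin 4 → ℝ) 1, Λ (x + latLen r • mkPt u)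

/-- `u ↦ mkPt u` is continuous. [folklore] -/
private theorem continuous_mkPt' : Continuous (fun u : Fin 4 → ℝ => (mkPt u : E4)) := by
  unfold mkPt; exact PiLp.continuous_toLp 2 _

/-- Continuous functions are integrable on boxes. [folklore] -/
private theorem integrableOn_box {G : (Fin 4 → ℝ) → ℝ} (hG : Continuous G) (a b : Fin 4 → ℝ) :
    IntegrableOn G (Icc a b) := hG.continuousOn.integrableOn_compact isCompact_Icc

/-- `u ↦ Λ(x + ℓ_r u)` is continuous. [folklore] -/
private theorem continuous_shifted (hΛ : Continuous Λ) (x : E4) (ℓ : ℝ) :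
    Continuous fun u : Fin 4 → ℝ => Λ (x + ℓ • mkPt u) :=
  hΛ.comp (continuous_const.add (continuous_mkPt'.fun_const_smul ℓ))

/-- **The level-`r` assignment (2.1)–(2.2) of a pure gauge is the lattice gradient of the box average**:
`A(e, r)[dΛ] = M_rΛ(x_{b + e_μ}) − M_rΛ(x_b)`. [cite: Federbush1986PhaseCellI, (2.1)–(2.2) p. 325, (1.13) p. 324] -/
theorem approxTop_pureGauge (hΛ : ContDiff ℝ 1 Λ) (r : ℕ) (b : Fin 4 → ℤ) (μ : Fin 4) :
    approxTop r (pureGauge Λ) ⟨b, μ⟩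
      = boxAvg r Λ ((⟨b + Pi.single μ 1, μ⟩ : Edge r).src) - boxAvg r Λ ((⟨b, μ⟩ : Edge r).src) := by
  set x₀ : E4 := (⟨b, μ⟩ : Edge r).src with hx₀
  set ℓ : ℝ := latLen r with hℓ
  set F : (Fin 4 → ℝ) → ℝ := fun u => Λ (x₀ + ℓ • unitVec μ + ℓ • mkPt u) with hF
  set G : (Fin 4 → ℝ) → ℝ := fun u => Λ (x₀ + ℓ • mkPt u) with hG
  have hFc : Continuous F := continuous_shifted hΛ.continuous _ _
  have hGc : Continuous G := continuous_shifted hΛ.continuous _ _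
  have h1 : approxTop r (pureGauge Λ) ⟨b, μ⟩ = ∫ u in Icc (0 : Fin 4 → ℝ) 1, (F u - G u) := by
    rw [← setIntegral_lineInt_eq_approxTop _ (continuous_pureGauge hΛ) ⟨b, μ⟩]
    refine setIntegral_congr_fun measurableSet_Icc fun u _ => ?_
    show lineInt (pureGauge Λ) (x₀ + ℓ • mkPt u) μ ℓ = F u - G u
    rw [lineInt_pureGauge hΛ, hF, hG]
    simp only [add_right_comm]
  have h2 : boxAvg r Λ ((⟨b + Pi.single μ 1, μ⟩ : Edge r).src) = ∫ u in Icc (0 : Fin 4 → ℝ) 1, F u := by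
    unfold boxAvg
    rw [Edge.src_shift]
  rw [h1, h2, integral_sub (integrableOn_box hFc 0 1) (integrableOn_box hGc 0 1)]
  rfl

/-- The same for the index-free configuration: `toCfg (A(·, r)[dΛ]) = ∇(v ↦ M_rΛ(x_v))`. [cite: Federbush1986PhaseCellI,
(2.1)–(2.2) p. 325] -/
theorem toCfg_approxTop_pureGauge (hΛ : ContDiff ℝ 1 Λ) (r : ℕ) :
    toCfg (approxTop r (pureGauge Λ)) = gradCfg (fun v => boxAvg r Λ ((⟨v, 0⟩ : Edge r).src)) := by
  funext b μ
  simp only [toCfg, gradCfg, approxTop_pureGauge hΛ]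
  rfl

/-- The level-`r` vertex `2^r n` is the level-0 vertex `n`: `x_{2^r n}^{(r)} = n ∈ ℤ⁴ ⊂ ℝ⁴`. [cite: Federbush1986PhaseCellI,
§1 p. 321 («the same point in R⁴»)] -/
theorem src_pow_two_mul (r : ℕ) (v : Fin 4 → ℤ) :
    (⟨fun k => 2 ^ r * v k, (0 : Fin 4)⟩ : Edge r).src = (⟨v, (0 : Fin 4)⟩ : Edge 0).src := by
  show mkPt _ = mkPt _
  congr 1
  funext k
  unfold latLen
  push_cast
  rw [pow_zero, inv_one, one_mul, ← mul_assoc, inv_mul_cancel₀ (pow_ne_zero r (two_ne_zero)), one_mul]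

/-! ## §3  The level-0 bond assignment (2.12) of a pure gauge -/

/-- **The level-0 approximant of a pure gauge**: `av_{0←r}(A(·,r)[dΛ])(n, i) = M_rΛ(n + e_i) − M_rΛ(n)`.
[cite: Federbush1986PhaseCellI, (1.10)–(1.11) p. 323–324, (2.1)–(2.2), (2.12) p. 325–326] -/
theorem bondApprox_pureGauge (hΛ : ContDiff ℝ 1 Λ) (r : ℕ) (n : Fin 4 → ℤ) (i : Fin 4) :
    axialTreeAveraging.bondApprox r 0 (pureGauge Λ) ⟨n, i⟩
      = boxAvg r Λ ((⟨n + Pi.single i 1, (0 : Fin 4)⟩ : Edge 0).src) - boxAvg r Λ ((⟨n, (0 : Fin 4)⟩ : Edge 0).src) := by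
  unfold AbelianAveraging.bondApprox
  rw [axialTreeAveraging_av_of_le (Nat.zero_le r), Nat.sub_zero, toCfg_approxTop_pureGauge hΛ, iterate_avStep_gradCfg]
  simp only [ofCfg, gradCfg, iterate_twice']
  rw [← src_pow_two_mul r (n + Pi.single i 1), ← src_pow_two_mul r n]

/-- `‖mkPt u‖ ≤ 2` on `[0,1]⁴`. [folklore] -/
private theorem norm_mkPt_le_two' {u : Fin 4 → ℝ} (hu : u ∈ Icc (0 : Fin 4 → ℝ) 1) : ‖(mkPt u : E4)‖ ≤ 2 := by
  have hi : ∀ i, ‖(mkPt u : E4) i‖ ^ 2 ≤ 1 := by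
    intro i
    have h0 : 0 ≤ u i := hu.1 i
    have h1 : u i ≤ 1 := hu.2 i
    simp only [mkPt, PiLp.toLp_apply, Real.norm_eq_abs, sq_abs]
    nlinarith
  rw [EuclideanSpace.norm_eq]
  calc Real.sqrt (∑ i, ‖(mkPt u : E4) i‖ ^ 2) ≤ Real.sqrt (∑ _i : Fin 4, (1 : ℝ)) :=
        Real.sqrt_le_sqrt (Finset.sum_le_sum fun i _ => hi i)
    _ = 2 := by
        rw [Finset.sum_const, Finset.card_univ, Fintype.card_fin, nsmul_eq_mul, mul_one,
          show ((4 : ℕ) : ℝ) = 2 ^ 2 by norm_num, Real.sqrt_sq (by norm_num)]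

/-- «a sequence of lattices, ℒ^r, with lattice ℒ^r having edge length ℓ_r = 1/2^r»: `ℓ_r → 0`. [cite: Federbush1986PhaseCellI,
§1 p. 321] -/
theorem tendsto_latLen : Tendsto latLen atTop (𝓝 0) := by
  have : latLen = fun r : ℕ => ((2 : ℝ) ^ r)⁻¹ := by funext r; unfold latLen; rfl
  rw [this]
  exact tendsto_inv_atTop_zero.comp (tendsto_pow_atTop_atTop_of_one_lt one_lt_two)

/-- The unit box has volume `1`. [folklore] -/
private theorem volume_real_unitBox : (volume : Measure (Fin 4 → ℝ)).real (Icc 0 1) = 1 := by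
  rw [measureReal_def, Real.volume_Icc_pi_toReal zero_le_one]
  simp

/-- **Box averages converge to the point value**: `M_rΛ(x) → Λ(x)` as `r → ∞` (continuity of `Λ`).
[cite: Federbush1986PhaseCellI, (2.12) p. 326 («the limit … exists»)] -/
theorem tendsto_boxAvg (hΛ : Continuous Λ) (x : E4) : Tendsto (fun r => boxAvg r Λ x) atTop (𝓝 (Λ x)) := by
  rw [Metric.tendsto_atTop]
  intro ε hε
  obtain ⟨δ, hδ, hδε⟩ := Metric.continuous_iff.1 hΛ x (ε / 2) (half_pos hε)
  obtain ⟨N, hN⟩ := Metric.tendsto_atTop.1 tendsto_latLen (δ / 2) (half_pos hδ)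
  refine ⟨N, fun r hr => ?_⟩
  have hℓ : latLen r < δ / 2 := by
    have := hN r hr
    rwa [Real.dist_eq, sub_zero, abs_of_pos (latLen_pos r)] at this
  have hconst : ∫ _u in Icc (0 : Fin 4 → ℝ) 1, Λ x = Λ x := by
    rw [setIntegral_const, volume_real_unitBox, one_smul]
  have hdiff : boxAvg r Λ x - Λ x = ∫ u in Icc (0 : Fin 4 → ℝ) 1, (Λ (x + latLen r • mkPt u) - Λ x) := by
    rw [integral_sub (integrableOn_box (continuous_shifted hΛ x _) 0 1) (integrableOn_box continuous_const 0 1), hconst]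
    rfl
  have hbound : ∀ u ∈ Icc (0 : Fin 4 → ℝ) 1, ‖Λ (x + latLen r • mkPt u) - Λ x‖ ≤ ε / 2 := by
    intro u hu
    have hd : dist (x + latLen r • mkPt u) x < δ := by
      rw [dist_eq_norm, add_sub_cancel_left, norm_smul, Real.norm_of_nonneg (latLen_pos r).le]
      calc latLen r * ‖(mkPt u : E4)‖ ≤ latLen r * 2 := mul_le_mul_of_nonneg_left (norm_mkPt_le_two' hu) (latLen_pos r).le
        _ < δ := by linarith
    have := hδε _ hd
    rw [Real.dist_eq] at this
    exact this.le
  rw [Real.dist_eq, hdiff]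
  calc |∫ u in Icc (0 : Fin 4 → ℝ) 1, (Λ (x + latLen r • mkPt u) - Λ x)|
      ≤ ε / 2 * (volume : Measure (Fin 4 → ℝ)).real (Icc 0 1) := by
        have := norm_setIntegral_le_of_norm_le_const (measure_Icc_lt_top (μ := (volume : Measure (Fin 4 → ℝ)))) hbound
        rwa [Real.norm_eq_abs] at this
    _ < ε := by rw [volume_real_unitBox]; linarith

/-- The level-0 approximants of a pure gauge converge to the lattice gradient of `Λ|ℤ⁴`. [cite: Federbush1986PhaseCellI,
(2.12) p. 326; §4 p. 329] -/
theorem tendsto_bondApprox_pureGauge (hΛ : ContDiff ℝ 1 Λ) (n : Fin 4 → ℤ) (i : Fin 4) :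
    Tendsto (fun r => axialTreeAveraging.bondApprox r 0 (pureGauge Λ) ⟨n, i⟩) atTop
      (𝓝 (Λ ((⟨n + Pi.single i 1, (0 : Fin 4)⟩ : Edge 0).src) - Λ ((⟨n, (0 : Fin 4)⟩ : Edge 0).src))) := by
  have h : (fun r => axialTreeAveraging.bondApprox r 0 (pureGauge Λ) ⟨n, i⟩)
      = fun r => boxAvg r Λ ((⟨n + Pi.single i 1, (0 : Fin 4)⟩ : Edge 0).src) - boxAvg r Λ ((⟨n, (0 : Fin 4)⟩ : Edge 0).src) :=
    funext fun r => bondApprox_pureGauge hΛ r n i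
  rw [h]
  exact (tendsto_boxAvg hΛ.continuous _).sub (tendsto_boxAvg hΛ.continuous _)

/-- **The level-0 bond assignment (2.12) of a pure gauge is the lattice gradient of `Λ|ℤ⁴`**:
`bond₀(dΛ)(n, i) = Λ(n + e_i) − Λ(n)` (for Bałaban averaging with the axial trees and corner base points).
[cite: Federbush1986PhaseCellI, §4 p. 329 («Mirabile dictu …»), (2.12) p. 326] -/
theorem bond_pureGauge (hΛ : ContDiff ℝ 1 Λ) (n : Fin 4 → ℤ) (i : Fin 4) :
    axialTreeAveraging.bond 0 (pureGauge Λ) ⟨n, i⟩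
      = Λ ((⟨n + Pi.single i 1, (0 : Fin 4)⟩ : Edge 0).src) - Λ ((⟨n, (0 : Fin 4)⟩ : Edge 0).src) := by
  unfold AbelianAveraging.bond
  exact (tendsto_bondApprox_pureGauge hΛ n i).limUnder_eq

/-! ## §4  Linearity and «Mirabile dictu» -/

/-- (2.1) is additive in the field. [cite: Federbush1986PhaseCellI, (2.1) p. 325] -/
theorem approxTop_add {A B : E4 → Fin 4 → ℝ} (hA : Continuous A) (hB : Continuous B) (r : ℕ) (e : Edge r) :
    approxTop r (fun x μ => A x μ + B x μ) e = approxTop r A e + approxTop r B e := by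
  have hc : ∀ {C : E4 → Fin 4 → ℝ}, Continuous C →
      Continuous fun u : Fin 4 → ℝ => tent (u e.dir) * C (e.src + latLen r • mkPt u) e.dir := fun hC =>
    (continuous_tent.comp (continuous_apply e.dir)).mul
      ((continuous_apply e.dir).comp (hC.comp (continuous_const.add (continuous_mkPt'.fun_const_smul _))))
  unfold approxTop
  rw [← mul_add, ← integral_add (integrableOn_box (hc hA) _ _) (integrableOn_box (hc hB) _ _)]
  congr 1
  refine setIntegral_congr_fun measurableSet_Icc fun u _ => ?_
  ring

/-- The level-`s ≤ r` approximants of the concrete averaging are additive in the field. [cite: Federbush1986PhaseCellI,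
(1.11) p. 324, (2.1) p. 325] -/
theorem bondApprox_add {A B : E4 → Fin 4 → ℝ} (hA : Continuous A) (hB : Continuous B) {s r : ℕ} (hs : s ≤ r)
    (e : Edge s) :
    axialTreeAveraging.bondApprox r s (fun x μ => A x μ + B x μ) e
      = axialTreeAveraging.bondApprox r s A e + axialTreeAveraging.bondApprox r s B e := by
  unfold AbelianAveraging.bondApprox
  rw [axialTreeAveraging_av_of_le hs, axialTreeAveraging_av_of_le hs, axialTreeAveraging_av_of_le hs]
  have h : toCfg (approxTop r (fun x μ => A x μ + B x μ))
      = fun b μ => toCfg (approxTop r A) b μ + toCfg (approxTop r B) b μ := by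
    funext b μ
    exact approxTop_add hA hB r ⟨b, μ⟩
  rw [h, iterate_avStep_add']
  rfl

/-- `bond₀(A + dΛ)(e) = bond₀(A)(e) + Λ(b) − Λ(a)` whenever the approximants of `A` converge (e.g. under (2.3)–(2.4), by
(2.12)). [cite: Federbush1986PhaseCellI, §4 p. 329, (2.12) p. 326] -/
theorem bond_add_pureGauge {A : E4 → Fin 4 → ℝ} (hA : Continuous A) (hΛ : ContDiff ℝ 1 Λ) (e : Edge 0)
    (hconv : Tendsto (fun r => axialTreeAveraging.bondApprox r 0 A e) atTop (𝓝 (axialTreeAveraging.bond 0 A e))) :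
    axialTreeAveraging.bond 0 (fun x μ => A x μ + pureGauge Λ x μ) e
      = axialTreeAveraging.bond 0 A e
        + (Λ ((⟨e.base + Pi.single e.dir 1, (0 : Fin 4)⟩ : Edge 0).src) - Λ ((⟨e.base, (0 : Fin 4)⟩ : Edge 0).src)) := by
  obtain ⟨n, i⟩ := e
  have h := hconv.add (tendsto_bondApprox_pureGauge hΛ n i)
  have h' : Tendsto (fun r => axialTreeAveraging.bondApprox r 0 (fun x μ => A x μ + pureGauge Λ x μ) ⟨n, i⟩) atTop
      (𝓝 (axialTreeAveraging.bond 0 A ⟨n, i⟩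
        + (Λ ((⟨n + Pi.single i 1, (0 : Fin 4)⟩ : Edge 0).src) - Λ ((⟨n, (0 : Fin 4)⟩ : Edge 0).src)))) :=
    h.congr fun r => (bondApprox_add hA (continuous_pureGauge hΛ) (Nat.zero_le r) ⟨n, i⟩).symm
  exact h'.limUnder_eq

/-- **«Mirabile dictu the bond assignments to e at level 0, due to this A_μ(x), are exactly the A(e).»**  For the concrete
averaging `axialTreeAveraging`: if `A^N ∈ C¹` obeys (2.3)–(2.4), `a(e) − A^N(e) = h(b) − h(a)` for all level-0 bonds
((4.3)) and `Λ ∈ C¹` interpolates `h` on `ℤ⁴` ((4.5)), then the level-0 bond assignments of `A = A^N + dΛ` ((3.2)) are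
exactly `a` (the field is `AbelianAveraging.gaugeTransform AN Λ` of `GaugeTransformDecay`, by `rfl`; spelt out here to keep the
imports low). [cite: Federbush1986PhaseCellI, §4 p. 329; (3.2) p. 327; (2.12) p. 326] -/
theorem bond_gaugeTransform_eq_data {AN : E4 → Fin 4 → ℝ} (hAN : ContDiff ℝ 1 AN) {B₁ B₂ : ℝ}
    (hB₁ : ∀ x μ, |AN x μ| ≤ B₁) (hB₂ : ∀ x ν μ, |pd AN ν μ x| ≤ B₂) (hΛ : ContDiff ℝ 1 Λ)
    {a : Edge 0 → ℝ} {h : (Fin 4 → ℤ) → ℝ}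
    (h43 : ∀ e : Edge 0, a e - axialTreeAveraging.bond 0 AN e = h (e.base + Pi.single e.dir 1) - h e.base)
    (h45 : ∀ n : Fin 4 → ℤ, Λ ((⟨n, (0 : Fin 4)⟩ : Edge 0).src) = h n) :
    axialTreeAveraging.bond 0 (fun x μ => AN x μ + fderiv ℝ Λ x (unitVec μ)) = a := by
  funext e
  show axialTreeAveraging.bond 0 (fun x μ => AN x μ + pureGauge Λ x μ) e = a e
  rw [bond_add_pureGauge hAN.continuous hΛ e (axialTreeAveraging_eq212 AN B₁ B₂ hAN hB₁ hB₂ 0 e), h45, h45, ← h43 e]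
  ring

/-- The same with `h` THE lattice gauge function of (4.3)–(4.4) (`LatticeGauge.gaugeFn` of `f = a − A^N(·)`, p253679):
hypotheses = `f` decays ((4.1)) and is curl-free (its plaquette assignments vanish), `Λ ∈ C¹` interpolates `gaugeFn f`
((4.5)). [cite: Federbush1986PhaseCellI, §4 (4.1), (4.3), (4.5) p. 328–329] -/
theorem bond_gaugeTransform_eq_data_of_gaugeFn {AN : E4 → Fin 4 → ℝ} (hAN : ContDiff ℝ 1 AN) {B₁ B₂ : ℝ}
    (hB₁ : ∀ x μ, |AN x μ| ≤ B₁) (hB₂ : ∀ x ν μ, |pd AN ν μ x| ≤ B₂) (hΛ : ContDiff ℝ 1 Λ)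
    {a : Edge 0 → ℝ} {c γ : ℝ} (hγ : 0 < γ)
    (hf : LatticeGauge.DecayBound (fun e => a e - axialTreeAveraging.bond 0 AN e) c γ)
    (hcurl : ∀ p : Plaq 0, plaqOfBonds (fun e => a e - axialTreeAveraging.bond 0 AN e) p = 0)
    (h45 : ∀ n : Fin 4 → ℤ,
      Λ ((⟨n, (0 : Fin 4)⟩ : Edge 0).src) = LatticeGauge.gaugeFn (fun e => a e - axialTreeAveraging.bond 0 AN e) n) :
    axialTreeAveraging.bond 0 (fun x μ => AN x μ + fderiv ℝ Λ x (unitVec μ)) = a :=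
  bond_gaugeTransform_eq_data hAN hB₁ hB₂ hΛ
    (fun e => by
      obtain ⟨x, μ⟩ := e
      exact (LatticeGauge.gaugeFn_bond hγ hf hcurl x μ).symm)
    h45

end

end Literature.MathematicalPhysics.QuantumFieldTheory.Federbush1986
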